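import Summits.HodgeConjecture.HodgeConjecture.Theorems.F0P3XiSideOfRecord          -- ★ p822580 (p01 (g8), K2): `xiSideOfRecord` (+ ★ K0, ★ p819611 `xiPacketFamilyOfRecord`, ★ p819116 `isUnitarizable_comap`)
import HarnessLib

/-!
# LETTER «XiLocalPacketUnitary» — the members of the finite local A-packets `Π(ξ_v)` are unitarizable (witness-free), and the glue `hFinU` for
# law `UnitaryPacket` AT `𝔠₀` (F0P3b's h10 `unitaryPacket_kitOfRecord_of … hFinU hJU hDU`)

Cell `hodgecm-mathlib`, F0∕P3 «U3-mult», crux H413 (`stmt-HodgeConjecture-24833`), rung 4; F0P3-p01 (g8) on F0P3b-plan (g7)'s DESK WORD 12:39:19Z (GO (β)); books = F0P3-plan (g5)'s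
call (P3b ledger: row 10 (UP) finite clause, k = 1, replacing the anonymous closer hypothesis `hFinU`).  DEF LANE (H2 = Theorems-side letter): ONE `def … : Prop` letter
(`XiLocalPacketUnitary`, CITED not proved) + glue theorems; no instance, no notation, no `sorry`.

PRINT.  For a one-dimensional automorphic `ξ` of `H` and a finite place `v` of `L⁺`: at a SPLIT `v` the packet `Π(ξ_v) = {πⁿ}` is the (irreducible) representation unitarily
induced from the unitary characters `ν₀ = η_w ψ_w μ_w`, `χ′ = ψ_w` [Rogawski1990 Lemma 4.13.1 (b); §12.2 (1) p. 173] — unitary; at a NON-SPLIT `v`, `πⁿ(ξ_v)` is a constituent of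
`i_G(χ_{ξ,v})` at the unitary reducibility point [§12.2 (2) p. 174; Keys] — unitary — and `πˢ(ξ_v)` is SUPERCUSPIDAL [Prop. 13.1.3 (d) p. 199], hence unitarizable because the
centre of `U(3)(L⁺_v)` (`= U(1)(L_w/L⁺_v)`) is COMPACT (an irreducible supercuspidal representation with unitary central character is unitarizable: its matrix coefficients are
compactly supported modulo the centre) [BushnellHenniart2006 §10.1–§11.1].

THE LETTER (§1) is WITNESS-FREE (REF1 rider-2 discipline, as (L3′) v2): it speaks of the Δ-free recipe classes only — the split member ★ `cmSplitPacket … (splitWitness v hs) …`,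
the Keys class `(keys ξ v hns).πn` ON `U(Φ₃)(L⁺_v)`, and «supercuspidal ⇒ unitarizable» on `U(H)(L⁺_v)` at NON-split `v` (FALSE at split `v`, where `U(H)_v ≅ GL₃`: twists
`⊗ |det|^s` — hence the non-split guard).  No T1 local data `(Δ, mH, mG, νG, νH, ξloc, hCM)`, no measure on `G′_v`.
THE GLUE (§2): **`hFinU_of_xiLocalPacketUnitary (hXU) : ∀ ξ v, (xiPacketFamilyOfRecord … ξ v).πn.IsUnitarizable ∧ ∀ s, (…).πs = some s → s.IsUnitarizable`** — split: ★
`xiPacketFamilyOfRecord_of_split` (+ `πs = none`); non-split: ★ `xiPacketFamilyOfRecord_of_nonsplit` — `πn = comap (…) (keys ξ v hns).πn` unitarizable by ★ `isUnitarizable_comap`,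
`πs = (hCM …).πs` supercuspidal by ★ `CMNonsplitCharIdentityAt.πs_isSupercuspidal`; and the same at `ξd₀ := xiSideOfRecord …` (`hFinU_xiSideOfRecord`, the literal `hFinU`
binder of F0P3b's `unitaryPacket_kitOfRecord_of`).

References: [Rogawski1990] §4.13 Lemma 4.13.1 (b); §12.2 (1)–(2) pp. 173–174; §13.1 Prop. 13.1.3 (d) p. 199; §13.3 p. 201; [BushnellHenniart2006] §10.1, §11.1.
HC_CM is proved only modulo the printed citations until rung 0 closes.
-/

set_option autoImplicit false
set_option linter.dupNamespace false

noncomputable section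

open NumberField IsDedekindDomain MeasureTheory
open Literature.NumberTheory.Rogawski1990 Literature.NumberTheory.GaloisRepresentations
open Literature.NumberTheory.Automorphic Literature.NumberTheory.Automorphic.UnitaryGroup
open scoped Matrix Classical

namespace Summit.HodgeConjecture.HodgeConjecture.Cruxes.H413.F0P3LettersXiLocalPacketUnitary

open Summit.HodgeConjecture.HodgeConjecture.Cruxes.H413.F0P3InnerFormClassificationV6
open Summit.HodgeConjecture.HodgeConjecture.Cruxes.H413.F0P3ClassTokenChoice (isUnitarizable_comap)
open Summit.HodgeConjecture.HodgeConjecture.Cruxes.H413.F0P3XiPacketFamilyOfRecord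
open Summit.HodgeConjecture.HodgeConjecture.Cruxes.H413.F0P3XiSideOfRecord (xiSideOfRecord)

variable (L : Type) [Field L] [NumberField L] [IsCMField L] (H : Matrix (Fin 3) (Fin 3) L)

/-! ## §1 The letter «XiLocalPacketUnitary» (witness-free) -/

/-- **LETTER «XiLocalPacketUnitary»** (CITED, not proved): (i) at a split `v`, the member `πⁿ` of the ★ D6 split packet of `ξ` at the fixed witness is unitarizable
[Lemma 4.13.1 (b); §12.2 (1)]; (ii) at a non-split `v`, the Keys class `(keys ξ v hns).πn` of `U(Φ₃)(L⁺_v)` is unitarizable [§12.2 (2) p. 174]; (iii) at a non-split `v`, every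
SUPERCUSPIDAL class of `U(H)(L⁺_v)` is unitarizable (compact centre) [Prop. 13.1.3 (d) p. 199; BushnellHenniart2006 §11.1].  No T1 witness, no measure.
[cite: Rogawski1990, §12.2 (1)–(2) pp. 173–174; §13.1 Prop. 13.1.3 (d) p. 199; §4.13 Lemma 4.13.1 (b)] [cite: BushnellHenniart2006, §11.1] -/
def XiLocalPacketUnitary
    (hH : (H.map (cmConjRingHom L))ᵀ = H) (hHd : IsUnit H.det) (μω : HeckeCharacter L) (hμu : μω.IsUnitary)
  [∀ v : HeightOneSpectrum (𝓞 ↥(maximalRealSubfield L)), MeasurableSpace (Gqs L v ⧸ Subgroup.center (Gqs L v))]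
  (μZ : ∀ v : HeightOneSpectrum (𝓞 ↥(maximalRealSubfield L)), Measure (Gqs L v ⧸ Subgroup.center (Gqs L v)))
  (keys : ∀ (ξ : OneDimAutRepH L) (v : HeightOneSpectrum (𝓞 ↥(maximalRealSubfield L))),
    (∀ w : PlacesOver L v, IsCMField.complexConj L • w.1 = w.1) →
      {p : IrrClass (Gqs L v) × IrrClass (Gqs L v) //
        KeysCaseTwoLabels L v (μω.semilocalComponent L v) (torusLocalComponent L (IsCMField.complexConj L) v ξ.η)
          (torusLocalComponent L (IsCMField.complexConj L) v ξ.ψ) p.1 p.2 ∧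
        p.1.IsSquareIntegrable (μZ v) ∧ ¬ p.2.IsSquareIntegrable (μZ v)})
    : Prop :=
  (∀ (ξ : OneDimAutRepH L) (v : Places L) (hs : ∃ w : PlacesOver L v, IsCMField.complexConj L • w.1 ≠ w.1),
      (cmSplitPacket L H hH hHd v (splitWitness v hs) (splitWitness_spec v hs) (ξ.splitν₀ μω (splitWitness v hs).1)
          (ξ.locψ (splitWitness v hs).1) (ξ.norm_splitν₀_apply hμu (splitWitness v hs).1)
          (ξ.continuous_splitν₀ μω (splitWitness v hs).1) (ξ.norm_locψ_apply (splitWitness v hs).1)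
          (ξ.continuous_locψ (splitWitness v hs).1)).πn.IsUnitarizable) ∧
  (∀ (ξ : OneDimAutRepH L) (v : Places L) (hns : ∀ w : PlacesOver L v, IsCMField.complexConj L • w.1 = w.1),
      ((keys ξ v hns).1.2).IsUnitarizable) ∧
  (∀ (v : Places L), (∀ w : PlacesOver L v, IsCMField.complexConj L • w.1 = w.1) →
      ∀ c : IrrClass ((cmDatum L 3 H).Local v), c.IsSupercuspidal → c.IsUnitarizable)

variable (hH : (H.map (cmConjRingHom L))ᵀ = H) (hHd : IsUnit H.det) (μω : HeckeCharacter L) (hμu : μω.IsUnitary)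
  [∀ v : HeightOneSpectrum (𝓞 ↥(maximalRealSubfield L)), MeasurableSpace (Gqs L v ⧸ Subgroup.center (Gqs L v))]
  (μZ : ∀ v : HeightOneSpectrum (𝓞 ↥(maximalRealSubfield L)), Measure (Gqs L v ⧸ Subgroup.center (Gqs L v)))
  (keys : ∀ (ξ : OneDimAutRepH L) (v : HeightOneSpectrum (𝓞 ↥(maximalRealSubfield L))),
    (∀ w : PlacesOver L v, IsCMField.complexConj L • w.1 = w.1) →
      {p : IrrClass (Gqs L v) × IrrClass (Gqs L v) //
        KeysCaseTwoLabels L v (μω.semilocalComponent L v) (torusLocalComponent L (IsCMField.complexConj L) v ξ.η)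
          (torusLocalComponent L (IsCMField.complexConj L) v ξ.ψ) p.1 p.2 ∧
        p.1.IsSquareIntegrable (μZ v) ∧ ¬ p.2.IsSquareIntegrable (μZ v)})

/-! ## §2 GLUE: `hFinU` for the packet of record (F0P3b's h10 `unitaryPacket_kitOfRecord_of … hFinU hJU hDU`) -/

section Glue

variable
  [∀ v : HeightOneSpectrum (𝓞 ↥(maximalRealSubfield L)),
    MeasurableSpace ((cmDatum L 2 (Matrix.of fun i j : Fin 2 => if i.val + j.val + 1 = 2 then (1 : L) else 0)).Local v ×
      (cmDatum L 1 (Matrix.of fun i j : Fin 1 => if i.val + j.val + 1 = 1 then (1 : L) else 0)).Local v)]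
  [∀ (v : HeightOneSpectrum (𝓞 ↥(maximalRealSubfield L)))
      (a : ((cmDatum L 2 (Matrix.of fun i j : Fin 2 => if i.val + j.val + 1 = 2 then (1 : L) else 0)).Local v ×
        (cmDatum L 1 (Matrix.of fun i j : Fin 1 => if i.val + j.val + 1 = 1 then (1 : L) else 0)).Local v)),
    MeasurableSpace (((cmDatum L 2 (Matrix.of fun i j : Fin 2 => if i.val + j.val + 1 = 2 then (1 : L) else 0)).Local v ×
        (cmDatum L 1 (Matrix.of fun i j : Fin 1 => if i.val + j.val + 1 = 1 then (1 : L) else 0)).Local v) ⧸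
      Subgroup.centralizer ({a} : Set ((cmDatum L 2 (Matrix.of fun i j : Fin 2 => if i.val + j.val + 1 = 2 then (1 : L) else 0)).Local v ×
        (cmDatum L 1 (Matrix.of fun i j : Fin 1 => if i.val + j.val + 1 = 1 then (1 : L) else 0)).Local v)))]
  [∀ (v : HeightOneSpectrum (𝓞 ↥(maximalRealSubfield L))) (γ : (cmDatum L 3 H).Local v),
    MeasurableSpace ((cmDatum L 3 H).Local v ⧸ Subgroup.centralizer ({γ} : Set ((cmDatum L 3 H).Local v)))]
  (Δ : ∀ v : HeightOneSpectrum (𝓞 ↥(maximalRealSubfield L)), LocalTransferFactor L H v)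
  (mH : ∀ v : HeightOneSpectrum (𝓞 ↥(maximalRealSubfield L)),
    OrbitalMeasureFamily ((cmDatum L 2 (Matrix.of fun i j : Fin 2 => if i.val + j.val + 1 = 2 then (1 : L) else 0)).Local v ×
      (cmDatum L 1 (Matrix.of fun i j : Fin 1 => if i.val + j.val + 1 = 1 then (1 : L) else 0)).Local v))
  (mG : ∀ v : HeightOneSpectrum (𝓞 ↥(maximalRealSubfield L)), letI : MeasurableSpace ((cmDatum L 3 H).Local v) := borel _; OrbitalMeasureFamily ((cmDatum L 3 H).Local v))
  (νG : ∀ v : HeightOneSpectrum (𝓞 ↥(maximalRealSubfield L)), @Measure ((cmDatum L 3 H).Local v) (borel _))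
  (νH : ∀ v : HeightOneSpectrum (𝓞 ↥(maximalRealSubfield L)),
    Measure ((cmDatum L 2 (Matrix.of fun i j : Fin 2 => if i.val + j.val + 1 = 2 then (1 : L) else 0)).Local v ×
      (cmDatum L 1 (Matrix.of fun i j : Fin 1 => if i.val + j.val + 1 = 1 then (1 : L) else 0)).Local v))
  (ξloc : OneDimAutRepH L → ∀ v : HeightOneSpectrum (𝓞 ↥(maximalRealSubfield L)),
    (cmDatum L 2 (Matrix.of fun i j : Fin 2 => if i.val + j.val + 1 = 2 then (1 : L) else 0)).Local v ×
      (cmDatum L 1 (Matrix.of fun i j : Fin 1 => if i.val + j.val + 1 = 1 then (1 : L) else 0)).Local v →* ℂˣ)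
  (hCM : letI : ∀ v : HeightOneSpectrum (𝓞 ↥(maximalRealSubfield L)), MeasurableSpace ((cmDatum L 3 H).Local v) := fun _ => borel _
    ∀ (ξ : OneDimAutRepH L) (v : HeightOneSpectrum (𝓞 ↥(maximalRealSubfield L)))
    (hns : ∀ w : PlacesOver L v, IsCMField.complexConj L • w.1 = w.1)
    (T : GL (Fin 3) (LocalRing L v)) (a : LocalRing L v) (ha : IsUnit a)
    (h : formCongr (conjLocal L (IsCMField.complexConj L) v) T (H.map (algebraMap L (LocalRing L v))) =
      a • (Matrix.of fun i j : Fin 3 => if i.val + j.val + 1 = 3 then (1 : L) else 0).map (algebraMap L (LocalRing L v)))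
    (π2 πn : IrrClass (Gqs L v)),
    KeysCaseTwoLabels L v (μω.semilocalComponent L v) (torusLocalComponent L (IsCMField.complexConj L) v ξ.η)
      (torusLocalComponent L (IsCMField.complexConj L) v ξ.ψ) π2 πn → ¬ πn.IsSquareIntegrable (μZ v) →
    CMNonsplitCharIdentityAt L v H (Δ v) (mH v) (mG v) (νG v) (νH v) (ξloc ξ v) (IrrClass.comap (cmDatumLocalCongr L v T ha h).symm πn))

/-- **`hFinU` FROM THE LETTER**: every member of the finite packet of record `xiPacketFamilyOfRecord … ξ v` (★ p819611) is unitarizable — split: ★ `xiPacketFamilyOfRecord_of_split`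
(member (i) of the letter; `πs = none`); non-split: ★ `xiPacketFamilyOfRecord_of_nonsplit` — `πn = comap (…) (keys ξ v hns).πn` by (ii) + ★ `isUnitarizable_comap`, `πs` supercuspidal
(★ `CMNonsplitCharIdentityAt.πs_isSupercuspidal`) hence unitarizable by (iii). [cite: Rogawski1990, §12.2 (1)–(2) pp. 173–174; §13.1 Prop. 13.1.3 (d) p. 199] -/
theorem hFinU_of_xiLocalPacketUnitary (hXU : XiLocalPacketUnitary L H hH hHd μω hμu μZ keys) :
    letI : ∀ v : HeightOneSpectrum (𝓞 ↥(maximalRealSubfield L)), MeasurableSpace ((cmDatum L 3 H).Local v) := fun _ => borel _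
    ∀ (ξ : OneDimAutRepH L) (v : Places L),
      (xiPacketFamilyOfRecord L H hH hHd μω hμu Δ mH mG νG νH ξloc μZ keys hCM ξ v).πn.IsUnitarizable ∧
        ∀ s : IrrClass ((cmDatum L 3 H).Local v),
          (xiPacketFamilyOfRecord L H hH hHd μω hμu Δ mH mG νG νH ξloc μZ keys hCM ξ v).πs = some s → s.IsUnitarizable := by
  letI : ∀ v : HeightOneSpectrum (𝓞 ↥(maximalRealSubfield L)), MeasurableSpace ((cmDatum L 3 H).Local v) := fun _ => borel _
  intro ξ v
  by_cases hs : ∃ w : PlacesOver L v, IsCMField.complexConj L • w.1 ≠ w.1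
  · rw [xiPacketFamilyOfRecord_of_split L H hH hHd μω hμu Δ mH mG νG νH ξloc μZ keys hCM ξ v hs]
    refine ⟨hXU.1 ξ v hs, fun s hs' => ?_⟩
    rw [cmSplitPacket_πs] at hs'
    exact absurd hs' (by simp)
  · have hns : ∀ w : PlacesOver L v, IsCMField.complexConj L • w.1 = w.1 := fun w => not_not.1 fun hw => hs ⟨w, hw⟩
    obtain ⟨T', a, ha, hT', hP, -⟩ := xiPacketFamilyOfRecord_of_nonsplit L H hH hHd μω hμu Δ mH mG νG νH ξloc μZ keys hCM ξ v hns
    rw [hP]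
    refine ⟨isUnitarizable_comap _ (hXU.2.1 ξ v hns), fun s hs' => ?_⟩
    obtain rfl := Option.some_injective _ hs'
    exact hXU.2.2 v hns _ (CMNonsplitCharIdentityAt.πs_isSupercuspidal _)

variable (hexc : ∀ ξ : OneDimAutRepH L, ∀ᶠ v : HeightOneSpectrum (𝓞 ↥(maximalRealSubfield L)) in Filter.cofinite,
      ∀ hns : ∀ w : PlacesOver L v, IsCMField.complexConj L • w.1 = w.1,
        ((keys ξ v hns).1.2).IsSpherical (cmLocalIntegralLevel L 3 (qsForm L) v))
  (μv : ∀ v : Places L, @Measure ((cmDatum L 3 H).Local v) (borel _))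
  {PG PH : Type} (evpG : PG → EvpData L H) (evpH : PH → EvpData L H) (ramG : PG → Finset (Places L)) (ramH : PH → Finset (Places L))
  (PiXi : OneDimAutRepH L → PG) (ρXi : OneDimAutRepH L → PH)

/-- **`hFinU` AT THE ξ-SIDE OF RECORD `ξd₀ := xiSideOfRecord …`** — literally the `hFinU` binder of F0P3b's `unitaryPacket_kitOfRecord_of` at `ξd := ξd₀` (`ξd₀.packFin = xiPacketFamilyOfRecord …`
by `rfl`). [cite: Rogawski1990, §12.2 (1)–(2) pp. 173–174; §13.1 Prop. 13.1.3 (d) p. 199] -/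
theorem hFinU_xiSideOfRecord (hXU : XiLocalPacketUnitary L H hH hHd μω hμu μZ keys) :
    letI : ∀ v : HeightOneSpectrum (𝓞 ↥(maximalRealSubfield L)), MeasurableSpace ((cmDatum L 3 H).Local v) := fun _ => borel _
    ∀ (ξ : OneDimAutRepH L) (v : Places L),
      ((xiSideOfRecord L H hH hHd μω hμu Δ mH mG νG νH ξloc μZ keys hCM hexc μv evpG evpH ramG ramH PiXi ρXi).packFin ξ v).πn.IsUnitarizable ∧
        ∀ s : IrrClass ((cmDatum L 3 H).Local v),
          ((xiSideOfRecord L H hH hHd μω hμu Δ mH mG νG νH ξloc μZ keys hCM hexc μv evpG evpH ramG ramH PiXi ρXi).packFin ξ v).πs = some s →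
            s.IsUnitarizable :=
  hFinU_of_xiLocalPacketUnitary L H hH hHd μω hμu μZ keys Δ mH mG νG νH ξloc hCM hXU

end Glue

end Summit.HodgeConjecture.HodgeConjecture.Cruxes.H413.F0P3LettersXiLocalPacketUnitary

end
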